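import Summits.BirchSwinnertonDyer.Rank1Residual.X11b.BeyondWindowRecords01
import Summits.BirchSwinnertonDyer.Rank1Residual.X11b.BeyondWindowRecords02
import Summits.BirchSwinnertonDyer.Rank1Residual.X11b.BeyondWindowRecords03
import Summits.BirchSwinnertonDyer.Rank1Residual.X11b.BeyondWindowRecords04
import Summits.BirchSwinnertonDyer.Rank1Residual.X11b.BeyondWindowRecords05
import Summits.BirchSwinnertonDyer.Rank1Residual.X11b.BeyondWindowRecords06
import Summits.BirchSwinnertonDyer.Rank1Residual.X11b.BeyondWindowRecords07
import Summits.BirchSwinnertonDyer.Rank1Residual.X11b.BeyondWindowRecords08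
import Summits.BirchSwinnertonDyer.Rank1Residual.X11b.BeyondWindowRecords09
import Summits.BirchSwinnertonDyer.Rank1Residual.X11b.BeyondWindowRecords10
import Summits.BirchSwinnertonDyer.Rank1Residual.X11b.BeyondWindowRecords11
import Summits.BirchSwinnertonDyer.Rank1Residual.X11b.BeyondWindowRecords12
import Summits.BirchSwinnertonDyer.Rank1Residual.X11b.BeyondWindowRecords13
import Summits.BirchSwinnertonDyer.Rank1Residual.X11b.BeyondWindowRecords14
import Summits.BirchSwinnertonDyer.Rank1Residual.X11b.BeyondWindowRecords15
import Summits.BirchSwinnertonDyer.Rank1Residual.X11b.BeyondWindowRecords16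
import Summits.BirchSwinnertonDyer.Rank1Residual.X11b.BeyondWindowRecords17
import Summits.BirchSwinnertonDyer.Rank1Residual.X11b.BeyondWindowRecords18
import Summits.BirchSwinnertonDyer.Rank1Residual.X11b.BeyondWindowRecords19
import Summits.BirchSwinnertonDyer.Rank1Residual.X11b.BeyondWindowRecords20
import Summits.BirchSwinnertonDyer.Rank1Residual.X11b.BeyondWindowRecords21
import Summits.BirchSwinnertonDyer.Rank1Residual.X11b.BeyondWindowRecords22
import Summits.BirchSwinnertonDyer.Rank1Residual.X11b.BeyondWindowRecords23
import Summits.BirchSwinnertonDyer.Rank1Residual.X11b.BeyondWindowRecords24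
import Summits.BirchSwinnertonDyer.Rank1Residual.X11b.BeyondWindowRecords25
import Summits.BirchSwinnertonDyer.Rank1Residual.X11b.BeyondWindowRecords26
import Summits.BirchSwinnertonDyer.Rank1Residual.X11b.BeyondWindowRecords27
import Summits.BirchSwinnertonDyer.Rank1Residual.X11b.BeyondWindowRecords28
import Summits.BirchSwinnertonDyer.Rank1Residual.X11b.BeyondWindowRecords29
import Summits.BirchSwinnertonDyer.Rank1Residual.X11b.BeyondWindowRecords30
import Summits.BirchSwinnertonDyer.Rank1Residual.X11b.BeyondWindowRecords31
import Summits.BirchSwinnertonDyer.Rank1Residual.X11b.BeyondWindowRecords32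
import Summits.BirchSwinnertonDyer.Rank1Residual.X11b.BeyondWindowRecords33
import Summits.BirchSwinnertonDyer.Rank1Residual.X11b.BeyondWindowRecords34
import Summits.BirchSwinnertonDyer.Rank1Residual.X11b.BeyondWindowRecords35
import Summits.BirchSwinnertonDyer.Rank1Residual.X11b.BeyondWindowRecords36
import Summits.BirchSwinnertonDyer.Rank1Residual.X11b.BeyondWindowRecords37
import Summits.BirchSwinnertonDyer.Rank1Residual.X11b.BeyondWindowRecords38
import Summits.BirchSwinnertonDyer.Rank1Residual.X11b.BeyondWindowRecords39
import Summits.BirchSwinnertonDyer.Rank1Residual.X11b.BeyondWindowRecords40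
import Summits.BirchSwinnertonDyer.Rank1Residual.X11b.BeyondWindowRecords41
import Summits.BirchSwinnertonDyer.Rank1Residual.X11b.BeyondWindowRecords42
import Summits.BirchSwinnertonDyer.Rank1Residual.X11b.BeyondWindowRecords43
import Summits.BirchSwinnertonDyer.Rank1Residual.X11b.BeyondWindowRecords44
import Summits.BirchSwinnertonDyer.Rank1Residual.X11b.BeyondWindowRecords45
import Summits.BirchSwinnertonDyer.Rank1Residual.X11b.BeyondWindowRecords46
import Summits.BirchSwinnertonDyer.Rank1Residual.X11b.BeyondWindowRecords47
import Summits.BirchSwinnertonDyer.Rank1Residual.X11b.BeyondWindowRecords48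
import Summits.BirchSwinnertonDyer.Rank1Residual.X11b.BeyondWindowRecords49
import Summits.BirchSwinnertonDyer.Rank1Residual.X11b.BeyondWindowRecords50
import Summits.BirchSwinnertonDyer.Rank1Residual.X11b.BeyondWindowRecords51
import Summits.BirchSwinnertonDyer.Rank1Residual.X11b.BeyondWindowRecords52
import Summits.BirchSwinnertonDyer.Rank1Residual.X11b.BeyondWindowRecords53
import Summits.BirchSwinnertonDyer.Rank1Residual.X11b.BeyondWindowRecords54
import Summits.BirchSwinnertonDyer.Rank1Residual.X11b.BeyondWindowRecords55
import Summits.BirchSwinnertonDyer.Rank1Residual.X11b.BeyondWindowRecords56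
import Summits.BirchSwinnertonDyer.Rank1Residual.X11b.BeyondWindowRecords57
import Summits.BirchSwinnertonDyer.Rank1Residual.X11b.BeyondWindowRecords58
import Summits.BirchSwinnertonDyer.Rank1Residual.X11b.BeyondWindowRecords59
import Summits.BirchSwinnertonDyer.Rank1Residual.X11b.BeyondWindowRecords60
import Summits.BirchSwinnertonDyer.Rank1Residual.X11b.BeyondWindowRecords61
import Summits.BirchSwinnertonDyer.Rank1Residual.X11b.BeyondWindowRecords62
import Summits.BirchSwinnertonDyer.Rank1Residual.X11b.BeyondWindowRecords63
import Summits.BirchSwinnertonDyer.Rank1Residual.X11b.BeyondWindowRecords64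
import Summits.BirchSwinnertonDyer.Rank1Residual.X11b.BeyondWindowRecords65
import Summits.BirchSwinnertonDyer.Rank1Residual.X11b.BeyondWindowRecords66
import Summits.BirchSwinnertonDyer.Rank1Residual.X11b.BeyondWindowRecords67
import Summits.BirchSwinnertonDyer.Rank1Residual.X11b.BeyondWindowRecords68
import Summits.BirchSwinnertonDyer.Rank1Residual.X11b.BeyondWindowRecords69
import Summits.BirchSwinnertonDyer.Rank1Residual.X11b.BeyondWindowRecords70
import Summits.BirchSwinnertonDyer.Rank1Residual.X11b.BeyondWindowSurjRecords01
import Summits.BirchSwinnertonDyer.Rank1Residual.X11b.BeyondWindowSurjRecords02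
import Summits.BirchSwinnertonDyer.Rank1Residual.X11b.BeyondWindowSurjRecords03
import Summits.BirchSwinnertonDyer.Rank1Residual.X11b.SemistableRecordsFinal
import HarnessLib

/-!
# BSD rank-≤1 residual cell, class X11b ∧ r = 1 ∧ p ≥ 5 BEYOND the window (`N < 5·10⁵`): ONE aggregate over the
# 73 batch record files of the campaign — `BSD(E,p)` for each of the 4268 records from the published facts
# + three numbers per pair

HONEST FRAMING (cell `b2b-bsdres-*`, verbatim): prove what is provable now; shrink each hard class
to its core with data; no claim beyond stated classes; COMBINATION classes deleted from PUBLISHED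
theorems only, CONSTRUCTION-shaped remainder typed; this is not "finishing BSD". Class X11b stays
CONSTRUCTION-SHAPED; everything here is PER PAIR; no lane verdict is changed; no named fact.

Unit `b2b-bsdres-x11c`, gens 9–11 (REPORT §19–§21). The campaign's universe = the lane's v4u residue of row X11b at
`p ≥ 5`, `N < 5·10⁵` (hyp GEN 15 `x11b_atoms_v4u.tsv`: 4 272 pairs, all rank 1) minus the 3 pairs without a published
divisibility source (RESISTANT, REPORT §4/§17) and `403280bd1@5` (REPORT §13) = 4 268 pairs. Each batch file
`X11b/BeyondWindowRecordsNN.lean` (70 files, pairs with a (ram) prime: Skinner 2016 Thm. A route, A31) /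
`X11b/BeyondWindowSurjRecords0N.lean` (3 files, (ram)-free pairs: Kato–Wuthrich surjective-image route, A32)
carries its records (schema `X11RankOneCertificates.Record`), ONE `decide +kernel` of `fullCheck` / `fullCheckSurj`
(`p` prime, `Δ ≠ 0`, global minimality, `Mult`, split type, `Ram` resp. `¬sst ∧ Surj`, `Irr`) and the per-batch
instantiation `bsdp_bwRecordsNN` / `bsdp_bwSurjRecords0N`. THIS file only AGGREGATES them:
* `bwRamBatches`, `bwSurjBatches` — the lists of batch lists; `bwAll = bwRamBatches.flatten ++ bwSurjBatches.flatten`;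
* **`bsdp_of_mem_bwAll`** — for every record `r ∈ bwAll`: Skinner 2016 Thm. A `hA` (A31), Kato–Wuthrich `hK` (A32),
  Stein–Wuthrich 2013 Thm. 6.1 `hJs`/`hJn` (A37), §4.2 height existence `hHs`/`hHn` (A38), Wuthrich 2014 Prop. 21 `hW`,
  GZK `hGZK` (A18), modularity `hmod`/`hpar`, and per record the three ENGINE numbers `hnum` (analytic rank 1, `#Ш_an`
  as recorded, the two-engine `p`-adic certificate `CertSplit`/`CertNonsplit`) ⟹ `∃ (p prime) (Δ ≠ 0) (globally
  minimal), BSDp r.curve r.p` — the same hypothesis list as the in-window aggregate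
  `bsdp_of_published_of_threeNumbers_window` (`X11b/SemistableRecordsFinal.lean`, 143 records);
* `length_bwAll : bwAll.length = 4268`;
* `windowAll` = the in-window list of `X11b/SemistableRecordsFinal.lean` (85 + 58 = 143 records, `N < 2·10⁴`) and
  **`bsdp_of_mem_laneResidue`**: for every record of `windowAll ++ bwAll` — i.e. every kernel record of the lane's X11b ∧ r = 1 ∧
  p ≥ 5 residue to `N < 5·10⁵` — the same published facts + its three numbers give `BSD(E,p)` (the in-window aggregate
  `bsdp_of_published_of_threeNumbers_window` and `bsdp_of_mem_bwAll`, side by side); `length_laneResidue`.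
What this does NOT do: it proves no class theorem and books nothing; per record `r_an = 1`, `#Ш_an` and the valuation
identity are ENGINE numbers (two engines per column; tables `HOME/b2b-bsdres-x11c/gen10/BEYOND-WINDOW-KERNEL.md`,
`BW-CERTIFICATES.tsv`, gen-11 supplement `gen11/`), entering as the hypothesis `hnum`; the published inputs are
hypotheses, not discharged.
Refs: [Skinner2016PacificMC] Thm. A; [Wuthrich2014] Thm. 3, Cor. 19, Prop. 21; [SteinWuthrich2013] Thm. 6.1, 7.3, §4.2;
[MazurTateTeitelbaum1986Invent] §II.10; [Serre1972] §1.12, Prop. 19; [Mazur1978] Prop. 6.3 (1); [Kraus1989]; [Cremona2006].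
-/

set_option autoImplicit false

noncomputable section

open scoped Classical

open WeierstrassCurve Literature.NumberTheory.EllipticCurves
  Literature.NumberTheory.EllipticCurves.ModularForms
  Literature.NumberTheory.EllipticCurves.Rank1Residual
  Literature.NumberTheory.EllipticCurves.Skinner2016
  Literature.NumberTheory.EllipticCurves.Wuthrich2014
  Literature.NumberTheory.EllipticCurves.SteinWuthrich2013
  Literature.NumberTheory.EllipticCurves.Rank1Residual.X11RankOneCertificates

namespace Summit.BirchSwinnertonDyer.Rank1Residual.X11b

/-- The (ram)-route batch lists `bwRecords01 … bwRecords70` (Skinner 2016 Thm. A route), as a list of lists. [folklore] -/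
def bwRamBatches : List (List Record) :=
  [bwRecords01, bwRecords02, bwRecords03, bwRecords04, bwRecords05, bwRecords06, bwRecords07, bwRecords08,
   bwRecords09, bwRecords10, bwRecords11, bwRecords12, bwRecords13, bwRecords14, bwRecords15, bwRecords16,
   bwRecords17, bwRecords18, bwRecords19, bwRecords20, bwRecords21, bwRecords22, bwRecords23, bwRecords24,
   bwRecords25, bwRecords26, bwRecords27, bwRecords28, bwRecords29, bwRecords30, bwRecords31, bwRecords32,
   bwRecords33, bwRecords34, bwRecords35, bwRecords36, bwRecords37, bwRecords38, bwRecords39, bwRecords40,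
   bwRecords41, bwRecords42, bwRecords43, bwRecords44, bwRecords45, bwRecords46, bwRecords47, bwRecords48,
   bwRecords49, bwRecords50, bwRecords51, bwRecords52, bwRecords53, bwRecords54, bwRecords55, bwRecords56,
   bwRecords57, bwRecords58, bwRecords59, bwRecords60, bwRecords61, bwRecords62, bwRecords63, bwRecords64,
   bwRecords65, bwRecords66, bwRecords67, bwRecords68, bwRecords69, bwRecords70]

/-- The (ram)-free batch lists `bwSurjRecords01 … 03` (Kato–Wuthrich surjective-image route). [folklore] -/
def bwSurjBatches : List (List Record) :=
  [bwSurjRecords01, bwSurjRecords02, bwSurjRecords03]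

/-- All beyond-window certificate records of the campaign: the (ram) batches then the (ram)-free batches. [folklore] -/
def bwAll : List Record := bwRamBatches.flatten ++ bwSurjBatches.flatten

/-- Every (ram) batch list `l` satisfies: its engine numbers + the (ram)-route published facts give the batch conclusion for
every record of `l` (`p` prime, `Δ ≠ 0`, global minimality and `BSD(E,p)`) — the 70 batch theorems `bsdp_bwRecordsNN`,
collected. [folklore] -/
theorem forall_bwRamBatches
    (hA : thmA_charIdeal_multiplicative)
    (hJs : thm61_splitMultiplicative) (hJn : thm61_nonsplitMultiplicative)
    (hHs : exists_isSplitMultCanonical) (hHn : exists_isMultCanonical)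
    (hGZK : rank_eq_analyticRank_of_analyticRank_le_one) (hpar : nonempty_modularParametrizationData) :
    ∀ l ∈ bwRamBatches, (∀ r ∈ l, ∀ [Fact r.p.Prime] [r.curve.IsElliptic] [r.curve.IsGloballyMinimal],
        r.curve.analyticRank = 1 ∧
        Literature.NumberTheory.EllipticCurves.shaAn r.curve = ((r.shaAn : ℚ) : ℂ) ∧
        (r.split = true → r.CertSplit) ∧ (r.split = false → r.CertNonsplit)) →
      ∀ r ∈ l,
        ∃ (_ : Fact r.p.Prime) (_ : r.curve.IsElliptic) (_ : r.curve.IsGloballyMinimal), BSDp r.curve r.p := by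
  unfold bwRamBatches
  exact List.forall_mem_cons.mpr ⟨fun hn r hr ↦ bsdp_bwRecords01 hA hJs hJn hHs hHn hGZK hpar hn r hr,
    List.forall_mem_cons.mpr ⟨fun hn r hr ↦ bsdp_bwRecords02 hA hJs hJn hHs hHn hGZK hpar hn r hr,
    List.forall_mem_cons.mpr ⟨fun hn r hr ↦ bsdp_bwRecords03 hA hJs hJn hHs hHn hGZK hpar hn r hr,
    List.forall_mem_cons.mpr ⟨fun hn r hr ↦ bsdp_bwRecords04 hA hJs hJn hHs hHn hGZK hpar hn r hr,
    List.forall_mem_cons.mpr ⟨fun hn r hr ↦ bsdp_bwRecords05 hA hJs hJn hHs hHn hGZK hpar hn r hr,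
    List.forall_mem_cons.mpr ⟨fun hn r hr ↦ bsdp_bwRecords06 hA hJs hJn hHs hHn hGZK hpar hn r hr,
    List.forall_mem_cons.mpr ⟨fun hn r hr ↦ bsdp_bwRecords07 hA hJs hJn hHs hHn hGZK hpar hn r hr,
    List.forall_mem_cons.mpr ⟨fun hn r hr ↦ bsdp_bwRecords08 hA hJs hJn hHs hHn hGZK hpar hn r hr,
    List.forall_mem_cons.mpr ⟨fun hn r hr ↦ bsdp_bwRecords09 hA hJs hJn hHs hHn hGZK hpar hn r hr,
    List.forall_mem_cons.mpr ⟨fun hn r hr ↦ bsdp_bwRecords10 hA hJs hJn hHs hHn hGZK hpar hn r hr,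
    List.forall_mem_cons.mpr ⟨fun hn r hr ↦ bsdp_bwRecords11 hA hJs hJn hHs hHn hGZK hpar hn r hr,
    List.forall_mem_cons.mpr ⟨fun hn r hr ↦ bsdp_bwRecords12 hA hJs hJn hHs hHn hGZK hpar hn r hr,
    List.forall_mem_cons.mpr ⟨fun hn r hr ↦ bsdp_bwRecords13 hA hJs hJn hHs hHn hGZK hpar hn r hr,
    List.forall_mem_cons.mpr ⟨fun hn r hr ↦ bsdp_bwRecords14 hA hJs hJn hHs hHn hGZK hpar hn r hr,
    List.forall_mem_cons.mpr ⟨fun hn r hr ↦ bsdp_bwRecords15 hA hJs hJn hHs hHn hGZK hpar hn r hr,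
    List.forall_mem_cons.mpr ⟨fun hn r hr ↦ bsdp_bwRecords16 hA hJs hJn hHs hHn hGZK hpar hn r hr,
    List.forall_mem_cons.mpr ⟨fun hn r hr ↦ bsdp_bwRecords17 hA hJs hJn hHs hHn hGZK hpar hn r hr,
    List.forall_mem_cons.mpr ⟨fun hn r hr ↦ bsdp_bwRecords18 hA hJs hJn hHs hHn hGZK hpar hn r hr,
    List.forall_mem_cons.mpr ⟨fun hn r hr ↦ bsdp_bwRecords19 hA hJs hJn hHs hHn hGZK hpar hn r hr,
    List.forall_mem_cons.mpr ⟨fun hn r hr ↦ bsdp_bwRecords20 hA hJs hJn hHs hHn hGZK hpar hn r hr,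
    List.forall_mem_cons.mpr ⟨fun hn r hr ↦ bsdp_bwRecords21 hA hJs hJn hHs hHn hGZK hpar hn r hr,
    List.forall_mem_cons.mpr ⟨fun hn r hr ↦ bsdp_bwRecords22 hA hJs hJn hHs hHn hGZK hpar hn r hr,
    List.forall_mem_cons.mpr ⟨fun hn r hr ↦ bsdp_bwRecords23 hA hJs hJn hHs hHn hGZK hpar hn r hr,
    List.forall_mem_cons.mpr ⟨fun hn r hr ↦ bsdp_bwRecords24 hA hJs hJn hHs hHn hGZK hpar hn r hr,
    List.forall_mem_cons.mpr ⟨fun hn r hr ↦ bsdp_bwRecords25 hA hJs hJn hHs hHn hGZK hpar hn r hr,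
    List.forall_mem_cons.mpr ⟨fun hn r hr ↦ bsdp_bwRecords26 hA hJs hJn hHs hHn hGZK hpar hn r hr,
    List.forall_mem_cons.mpr ⟨fun hn r hr ↦ bsdp_bwRecords27 hA hJs hJn hHs hHn hGZK hpar hn r hr,
    List.forall_mem_cons.mpr ⟨fun hn r hr ↦ bsdp_bwRecords28 hA hJs hJn hHs hHn hGZK hpar hn r hr,
    List.forall_mem_cons.mpr ⟨fun hn r hr ↦ bsdp_bwRecords29 hA hJs hJn hHs hHn hGZK hpar hn r hr,
    List.forall_mem_cons.mpr ⟨fun hn r hr ↦ bsdp_bwRecords30 hA hJs hJn hHs hHn hGZK hpar hn r hr,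
    List.forall_mem_cons.mpr ⟨fun hn r hr ↦ bsdp_bwRecords31 hA hJs hJn hHs hHn hGZK hpar hn r hr,
    List.forall_mem_cons.mpr ⟨fun hn r hr ↦ bsdp_bwRecords32 hA hJs hJn hHs hHn hGZK hpar hn r hr,
    List.forall_mem_cons.mpr ⟨fun hn r hr ↦ bsdp_bwRecords33 hA hJs hJn hHs hHn hGZK hpar hn r hr,
    List.forall_mem_cons.mpr ⟨fun hn r hr ↦ bsdp_bwRecords34 hA hJs hJn hHs hHn hGZK hpar hn r hr,
    List.forall_mem_cons.mpr ⟨fun hn r hr ↦ bsdp_bwRecords35 hA hJs hJn hHs hHn hGZK hpar hn r hr,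
    List.forall_mem_cons.mpr ⟨fun hn r hr ↦ bsdp_bwRecords36 hA hJs hJn hHs hHn hGZK hpar hn r hr,
    List.forall_mem_cons.mpr ⟨fun hn r hr ↦ bsdp_bwRecords37 hA hJs hJn hHs hHn hGZK hpar hn r hr,
    List.forall_mem_cons.mpr ⟨fun hn r hr ↦ bsdp_bwRecords38 hA hJs hJn hHs hHn hGZK hpar hn r hr,
    List.forall_mem_cons.mpr ⟨fun hn r hr ↦ bsdp_bwRecords39 hA hJs hJn hHs hHn hGZK hpar hn r hr,
    List.forall_mem_cons.mpr ⟨fun hn r hr ↦ bsdp_bwRecords40 hA hJs hJn hHs hHn hGZK hpar hn r hr,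
    List.forall_mem_cons.mpr ⟨fun hn r hr ↦ bsdp_bwRecords41 hA hJs hJn hHs hHn hGZK hpar hn r hr,
    List.forall_mem_cons.mpr ⟨fun hn r hr ↦ bsdp_bwRecords42 hA hJs hJn hHs hHn hGZK hpar hn r hr,
    List.forall_mem_cons.mpr ⟨fun hn r hr ↦ bsdp_bwRecords43 hA hJs hJn hHs hHn hGZK hpar hn r hr,
    List.forall_mem_cons.mpr ⟨fun hn r hr ↦ bsdp_bwRecords44 hA hJs hJn hHs hHn hGZK hpar hn r hr,
    List.forall_mem_cons.mpr ⟨fun hn r hr ↦ bsdp_bwRecords45 hA hJs hJn hHs hHn hGZK hpar hn r hr,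
    List.forall_mem_cons.mpr ⟨fun hn r hr ↦ bsdp_bwRecords46 hA hJs hJn hHs hHn hGZK hpar hn r hr,
    List.forall_mem_cons.mpr ⟨fun hn r hr ↦ bsdp_bwRecords47 hA hJs hJn hHs hHn hGZK hpar hn r hr,
    List.forall_mem_cons.mpr ⟨fun hn r hr ↦ bsdp_bwRecords48 hA hJs hJn hHs hHn hGZK hpar hn r hr,
    List.forall_mem_cons.mpr ⟨fun hn r hr ↦ bsdp_bwRecords49 hA hJs hJn hHs hHn hGZK hpar hn r hr,
    List.forall_mem_cons.mpr ⟨fun hn r hr ↦ bsdp_bwRecords50 hA hJs hJn hHs hHn hGZK hpar hn r hr,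
    List.forall_mem_cons.mpr ⟨fun hn r hr ↦ bsdp_bwRecords51 hA hJs hJn hHs hHn hGZK hpar hn r hr,
    List.forall_mem_cons.mpr ⟨fun hn r hr ↦ bsdp_bwRecords52 hA hJs hJn hHs hHn hGZK hpar hn r hr,
    List.forall_mem_cons.mpr ⟨fun hn r hr ↦ bsdp_bwRecords53 hA hJs hJn hHs hHn hGZK hpar hn r hr,
    List.forall_mem_cons.mpr ⟨fun hn r hr ↦ bsdp_bwRecords54 hA hJs hJn hHs hHn hGZK hpar hn r hr,
    List.forall_mem_cons.mpr ⟨fun hn r hr ↦ bsdp_bwRecords55 hA hJs hJn hHs hHn hGZK hpar hn r hr,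
    List.forall_mem_cons.mpr ⟨fun hn r hr ↦ bsdp_bwRecords56 hA hJs hJn hHs hHn hGZK hpar hn r hr,
    List.forall_mem_cons.mpr ⟨fun hn r hr ↦ bsdp_bwRecords57 hA hJs hJn hHs hHn hGZK hpar hn r hr,
    List.forall_mem_cons.mpr ⟨fun hn r hr ↦ bsdp_bwRecords58 hA hJs hJn hHs hHn hGZK hpar hn r hr,
    List.forall_mem_cons.mpr ⟨fun hn r hr ↦ bsdp_bwRecords59 hA hJs hJn hHs hHn hGZK hpar hn r hr,
    List.forall_mem_cons.mpr ⟨fun hn r hr ↦ bsdp_bwRecords60 hA hJs hJn hHs hHn hGZK hpar hn r hr,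
    List.forall_mem_cons.mpr ⟨fun hn r hr ↦ bsdp_bwRecords61 hA hJs hJn hHs hHn hGZK hpar hn r hr,
    List.forall_mem_cons.mpr ⟨fun hn r hr ↦ bsdp_bwRecords62 hA hJs hJn hHs hHn hGZK hpar hn r hr,
    List.forall_mem_cons.mpr ⟨fun hn r hr ↦ bsdp_bwRecords63 hA hJs hJn hHs hHn hGZK hpar hn r hr,
    List.forall_mem_cons.mpr ⟨fun hn r hr ↦ bsdp_bwRecords64 hA hJs hJn hHs hHn hGZK hpar hn r hr,
    List.forall_mem_cons.mpr ⟨fun hn r hr ↦ bsdp_bwRecords65 hA hJs hJn hHs hHn hGZK hpar hn r hr,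
    List.forall_mem_cons.mpr ⟨fun hn r hr ↦ bsdp_bwRecords66 hA hJs hJn hHs hHn hGZK hpar hn r hr,
    List.forall_mem_cons.mpr ⟨fun hn r hr ↦ bsdp_bwRecords67 hA hJs hJn hHs hHn hGZK hpar hn r hr,
    List.forall_mem_cons.mpr ⟨fun hn r hr ↦ bsdp_bwRecords68 hA hJs hJn hHs hHn hGZK hpar hn r hr,
    List.forall_mem_cons.mpr ⟨fun hn r hr ↦ bsdp_bwRecords69 hA hJs hJn hHs hHn hGZK hpar hn r hr,
    List.forall_mem_cons.mpr ⟨fun hn r hr ↦ bsdp_bwRecords70 hA hJs hJn hHs hHn hGZK hpar hn r hr,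
    fun _ h ↦ nomatch h⟩⟩⟩⟩⟩⟩⟩⟩⟩⟩⟩⟩⟩⟩⟩⟩⟩⟩⟩⟩⟩⟩⟩⟩⟩⟩⟩⟩⟩⟩⟩⟩⟩⟩⟩⟩⟩⟩⟩⟩⟩⟩⟩⟩⟩⟩⟩⟩⟩⟩⟩⟩⟩⟩⟩⟩⟩⟩⟩⟩⟩⟩⟩⟩⟩⟩⟩⟩⟩⟩

/-- Every (ram)-free batch list `l` satisfies: its engine numbers + the surjective-image-route published facts
give the same conclusion for every record of `l` — the 3 batch theorems `bsdp_bwSurjRecords0N`, collected. [folklore] -/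
theorem forall_bwSurjBatches
    (hK : kato_charIdeal_dvd_multiplicative_of_surjective)
    (hJs : thm61_splitMultiplicative) (hJn : thm61_nonsplitMultiplicative)
    (hHs : exists_isSplitMultCanonical) (hHn : exists_isMultCanonical)
    (hW : Wuthrich2014.sha_dvd_analyticSha) (hGZK : rank_eq_analyticRank_of_analyticRank_le_one)
    (hmod : hasEntireLFunction_rat) (hpar : nonempty_modularParametrizationData) :
    ∀ l ∈ bwSurjBatches, (∀ r ∈ l, ∀ [Fact r.p.Prime] [r.curve.IsElliptic] [r.curve.IsGloballyMinimal],
        r.curve.analyticRank = 1 ∧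
        Literature.NumberTheory.EllipticCurves.shaAn r.curve = ((r.shaAn : ℚ) : ℂ) ∧
        (r.split = true → r.CertSplit) ∧ (r.split = false → r.CertNonsplit)) →
      ∀ r ∈ l,
        ∃ (_ : Fact r.p.Prime) (_ : r.curve.IsElliptic) (_ : r.curve.IsGloballyMinimal), BSDp r.curve r.p := by
  unfold bwSurjBatches
  exact List.forall_mem_cons.mpr ⟨fun hn r hr ↦ bsdp_bwSurjRecords01 hK hJs hJn hHs hHn hW hGZK hmod hpar hn r hr,
    List.forall_mem_cons.mpr ⟨fun hn r hr ↦ bsdp_bwSurjRecords02 hK hJs hJn hHs hHn hW hGZK hmod hpar hn r hr,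
    List.forall_mem_cons.mpr ⟨fun hn r hr ↦ bsdp_bwSurjRecords03 hK hJs hJn hHs hHn hW hGZK hmod hpar hn r hr,
    fun _ h ↦ nomatch h⟩⟩⟩

/-- **`BSD(E,p)` for EVERY beyond-window record of the campaign** (4268 records, `N < 5·10⁵`, row X11b, `r = 1`,
`p ≥ 5`): Skinner 2016 Thm. A `hA` (A31), Kato–Wuthrich surjective-image divisibility `hK` (A32), Stein–Wuthrich
2013 Thm. 6.1 `hJs`/`hJn` (A37), §4.2 height existence `hHs`/`hHn` (A38), Wuthrich 2014 Prop. 21 `hW`, GZK `hGZK`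
(A18), modularity `hmod`/`hpar`, and per record its three engine numbers `hnum` ⟹ `p` prime, `Δ ≠ 0`, Cremona's
model globally minimal (all three from the kernel checks) and Miller's `BSD(E,p)`. Per pair; class label unchanged;
nothing booked. [cite: Skinner2016PacificMC, Thm. A] [cite: Wuthrich2014, Thm. 3 (p. 383), Cor. 19 (p. 398), Prop. 21 (p. 400)]
[cite: SteinWuthrich2013, Thm. 6.1 (p. 20), Thm. 7.3 (p. 22) and §4.2] [cite: MazurTateTeitelbaum1986Invent, §I.10–I.14 and §II.10] -/
theorem bsdp_of_mem_bwAll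
    (hA : thmA_charIdeal_multiplicative) (hK : kato_charIdeal_dvd_multiplicative_of_surjective)
    (hJs : thm61_splitMultiplicative) (hJn : thm61_nonsplitMultiplicative)
    (hHs : exists_isSplitMultCanonical) (hHn : exists_isMultCanonical)
    (hW : Wuthrich2014.sha_dvd_analyticSha) (hGZK : rank_eq_analyticRank_of_analyticRank_le_one)
    (hmod : hasEntireLFunction_rat) (hpar : nonempty_modularParametrizationData)
    (hnum : ∀ r ∈ bwAll, ∀ [Fact r.p.Prime] [r.curve.IsElliptic] [r.curve.IsGloballyMinimal],
        r.curve.analyticRank = 1 ∧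
        Literature.NumberTheory.EllipticCurves.shaAn r.curve = ((r.shaAn : ℚ) : ℂ) ∧
        (r.split = true → r.CertSplit) ∧ (r.split = false → r.CertNonsplit))
    (r : Record) (hr : r ∈ bwAll) :
    ∃ (_ : Fact r.p.Prime) (_ : r.curve.IsElliptic) (_ : r.curve.IsGloballyMinimal), BSDp r.curve r.p := by
  rcases List.mem_append.mp hr with h | h
  · obtain ⟨l, hl, hrl⟩ := List.mem_flatten.mp h
    exact forall_bwRamBatches hA hJs hJn hHs hHn hGZK hpar l hl
      (fun r' h' ↦ hnum r' (List.mem_append.mpr (Or.inl (List.mem_flatten.mpr ⟨l, hl, h'⟩)))) r hrl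
  · obtain ⟨l, hl, hrl⟩ := List.mem_flatten.mp h
    exact forall_bwSurjBatches hK hJs hJn hHs hHn hW hGZK hmod hpar l hl
      (fun r' h' ↦ hnum r' (List.mem_append.mpr (Or.inr (List.mem_flatten.mpr ⟨l, hl, h'⟩)))) r hrl

/-- The campaign's record count: `bwAll.length = 4268`. [folklore] -/
theorem length_bwAll : bwAll.length = 4268 := by
  simp only [bwAll, bwRamBatches, bwSurjBatches, List.length_append, List.flatten_cons, List.flatten_nil,
    List.append_nil, length_bwRecords01,
    length_bwRecords02,
    length_bwRecords03,
    length_bwRecords04,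
    length_bwRecords05,
    length_bwRecords06,
    length_bwRecords07,
    length_bwRecords08,
    length_bwRecords09,
    length_bwRecords10,
    length_bwRecords11,
    length_bwRecords12,
    length_bwRecords13,
    length_bwRecords14,
    length_bwRecords15,
    length_bwRecords16,
    length_bwRecords17,
    length_bwRecords18,
    length_bwRecords19,
    length_bwRecords20,
    length_bwRecords21,
    length_bwRecords22,
    length_bwRecords23,
    length_bwRecords24,
    length_bwRecords25,
    length_bwRecords26,
    length_bwRecords27,
    length_bwRecords28,
    length_bwRecords29,
    length_bwRecords30,
    length_bwRecords31,
    length_bwRecords32,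
    length_bwRecords33,
    length_bwRecords34,
    length_bwRecords35,
    length_bwRecords36,
    length_bwRecords37,
    length_bwRecords38,
    length_bwRecords39,
    length_bwRecords40,
    length_bwRecords41,
    length_bwRecords42,
    length_bwRecords43,
    length_bwRecords44,
    length_bwRecords45,
    length_bwRecords46,
    length_bwRecords47,
    length_bwRecords48,
    length_bwRecords49,
    length_bwRecords50,
    length_bwRecords51,
    length_bwRecords52,
    length_bwRecords53,
    length_bwRecords54,
    length_bwRecords55,
    length_bwRecords56,
    length_bwRecords57,
    length_bwRecords58,
    length_bwRecords59,
    length_bwRecords60,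
    length_bwRecords61,
    length_bwRecords62,
    length_bwRecords63,
    length_bwRecords64,
    length_bwRecords65,
    length_bwRecords66,
    length_bwRecords67,
    length_bwRecords68,
    length_bwRecords69,
    length_bwRecords70,
    length_bwSurjRecords01,
    length_bwSurjRecords02,
    length_bwSurjRecords03]

/-- The in-window record list of `X11b/SemistableRecordsFinal.lean`: the 85 non-semistable records (`records1 ++ records2`,
`X11RankOneCertificates/RecordsN20000Part1/2`) and the 58 semistable ones (`sstRecords1 ++ sstRecords2`), 143 records with
`N < 2·10⁴`. [folklore] -/
def windowAll : List Record := (records1 ++ records2) ++ (sstRecords1 ++ sstRecords2)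

/-- **`BSD(E,p)` for EVERY kernel record of the lane's X11b ∧ r = 1 ∧ p ≥ 5 residue to `N < 5·10⁵`** — the 143 in-window records
(`windowAll`) and the 4268 beyond-window records (`bwAll`): the in-window aggregate `bsdp_of_published_of_threeNumbers_window`
(gen 9) and `bsdp_of_mem_bwAll` side by side, from Skinner 2016 Thm. A `hA`, Kato–Wuthrich `hK`, Stein–Wuthrich 2013 Thm. 6.1
`hJs`/`hJn`, §4.2 height existence `hHs`/`hHn`, Wuthrich 2014 Prop. 21 `hW`, GZK `hGZK`, modularity `hmod`/`hpar` and per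
record its three engine numbers `hnum`. Per pair; class label unchanged; nothing booked. (102 beyond-window records have
`N < 2·10⁴`; 89 of them are second certificates of in-window pairs — harmless duplicates in a membership statement.)
[cite: Skinner2016PacificMC, Thm. A] [cite: Wuthrich2014, Thm. 3 (p. 383), Cor. 19 (p. 398), Prop. 21 (p. 400)]
[cite: SteinWuthrich2013, Thm. 6.1 (p. 20), Thm. 7.3 (p. 22) and §4.2] -/
theorem bsdp_of_mem_laneResidue
    (hA : thmA_charIdeal_multiplicative) (hK : kato_charIdeal_dvd_multiplicative_of_surjective)
    (hJs : thm61_splitMultiplicative) (hJn : thm61_nonsplitMultiplicative)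
    (hHs : exists_isSplitMultCanonical) (hHn : exists_isMultCanonical)
    (hW : Wuthrich2014.sha_dvd_analyticSha) (hGZK : rank_eq_analyticRank_of_analyticRank_le_one)
    (hmod : hasEntireLFunction_rat) (hpar : nonempty_modularParametrizationData)
    (hnum : ∀ r ∈ windowAll ++ bwAll, ∀ [Fact r.p.Prime] [r.curve.IsElliptic] [r.curve.IsGloballyMinimal],
        r.curve.analyticRank = 1 ∧
        Literature.NumberTheory.EllipticCurves.shaAn r.curve = ((r.shaAn : ℚ) : ℂ) ∧
        (r.split = true → r.CertSplit) ∧ (r.split = false → r.CertNonsplit))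
    (r : Record) (hr : r ∈ windowAll ++ bwAll) : BSDp r.curve r.p := by
  rcases List.mem_append.mp hr with h | h
  · exact bsdp_of_published_of_threeNumbers_window hK hA hJs hJn hHs hHn hW hGZK hmod hpar
      (fun r' h' ↦ hnum r' (List.mem_append.mpr (Or.inl h'))) r h
  · obtain ⟨_, _, _, hb⟩ := bsdp_of_mem_bwAll hA hK hJs hJn hHs hHn hW hGZK hmod hpar
      (fun r' h' ↦ hnum r' (List.mem_append.mpr (Or.inr h'))) r h
    exact hb

/-- Record count of the lane residue lists: `143 + 4268`. [folklore] -/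
theorem length_laneResidue : (windowAll ++ bwAll).length = 4411 := by
  rw [List.length_append, length_bwAll]; unfold windowAll; rw [length_window]

end Summit.BirchSwinnertonDyer.Rank1Residual.X11b

end
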